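import Summits.Parity.GeneralizedHardyLittlewood.Theorems.LeeYangFibresCellParityLawModelDensityBounds
import Summits.Parity.GeneralizedHardyLittlewood.Theorems.LeeYangFibresAbsoluteUpgradeAnatomyAlong
import Summits.Parity.GeneralizedHardyLittlewood.Theorems.LeeYangFibresAbsoluteUpgradeQuantClipNumerics
import HarnessLib

/-!
# Route `LeeYangFibres`, crux `CellParityLawSaving` (stmt-Parity-18104), line `superpoly-band-same-atom`
# (payload slug `SketchIdeator3`): the registered stub `stub_densityAlong` — anatomy of the rough `Ω`-cells
# ALONG THE SCHEDULE in log-power currency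

We prove the registered stub `stub_densityAlong` of the skeleton
`Cruxes/CellParityLawSaving/Lines/SketchIdeator3.lean`: for every `ε > 0` and all large `N`, with
`U = U(N) = slowDegree N = max 4 ⌊√(log log N)/2⌋` and `a_m = modelDensity N U m = A_m(N)/N`,
`A_m(N) = #{n ≤ N : P⁻(n) > N^{1/U}, Ω(n) = m}`,

* `a_m ≤ (log N)^ε / log N` for every `m`;
* `(log N)^{-ε} / log N ≤ a_m` for `1 ≤ m < U`;
* `a_m = 0` for `m ≥ U`.

How.  The landed anatomy along the schedule (`stub_anatomyAlong : AnatomyAlong`, file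
`LeeYangFibresAbsoluteUpgradeAnatomyAlong.lean`) gives, for `1 ≤ m < U`,
`A_m(N) log N / N = I_m(U) (1 ± e^{-U²}/8)`, so `(7/8) I_m(U) ≤ a_m log N ≤ (9/8) I_m(U)` with
`I_m(U) = cellDensity (m-1) U`; the densities satisfy `1/(U^U)² ≤ I_m(U) ≤ U`
(`anatomyAlong_densityLower_nat`, `cellDensity_le_self`); and along the schedule `exp(4U²) ≤ log N`
(`quantClip_schedule`), so `(log N)^ε ≥ exp(4εU²) ≥ (2 U^U)² = 4 (U^U)²` as soon as `2 U^U ≤ exp(2εU²)`,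
which holds for `U ≥ U₀(ε)` (`quantClip_powSelf_le_exp`).  Hence `a_m log N ≤ (9/8) U ≤ 4 (U^U)² ≤ (log N)^ε`
and `a_m log N ≥ (7/8)/(U^U)² ≥ (7/2) (log N)^{-ε} ≥ (log N)^{-ε}`.  The top cells `m ≥ U` vanish
(`modelDensity_eq_zero`), and the cell `m = 0` is empty (`Ω(n) = 0` forces `n = 1`, whose least prime
factor `1` is not `> N^{1/U} ≥ 1`).

Sources: K. Alladi, Quart. J. Math. Oxford (2) 33 (1982) 129–148 (cell asymptotics `A_m(N) ∼ I_m(u) N/log N`);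
G. Tenenbaum, *Introduction to analytic and probabilistic number theory*, III.6.  No named fact is used: everything
is composed from landed tree theorems.
-/

noncomputable section

open scoped BigOperators Classical
open Finset Filter Literature.NumberTheory.Sieve
open Summit.Parity.GeneralizedHardyLittlewood.Cruxes.CellParityLaw.SectionAnnihilator
open Summit.Parity.GeneralizedHardyLittlewood.Cruxes.AbsoluteUpgrade.DipMarginRateExchange (slowDegree
  four_le_slowDegree quantClip_schedule AnatomyAlong stub_anatomyAlong)
open Summit.Parity.GeneralizedHardyLittlewood.Cruxes.ModelHyperbolicity.WindowChainTransport (cellDensity)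
open Summit.Parity.GeneralizedHardyLittlewood.Theorems.ModelHyperbolicity.Negative (cell)

namespace Summit.Parity.GeneralizedHardyLittlewood.Cruxes.CellParityLawSaving.SuperPolyBand

open Summit.Parity.GeneralizedHardyLittlewood.Cruxes.AbsoluteUpgrade.DipMarginRateExchange
  (quantClip_powSelf_le_exp cellDensity_le_self anatomyAlong_densityLower_nat)
open Summit.Parity.GeneralizedHardyLittlewood.Cruxes.ModelHyperbolicity.WindowChainTransport (calc_nonneg)

namespace DensityAlongAux

/-- The model density is the model cell count over `N`: `a_m = A_m(N)/N` (definitional). -/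
theorem modelDensity_eq_cell_div (N u m : ℕ) : modelDensity N u m = (cell u N m : ℝ) / N := rfl

/-- The cell `m = 0` is empty: `Ω(n) = 0` with `1 ≤ n` forces `n = 1`, and `P⁻(1) = 1` is not `> N^{1/u} ≥ 1`
(for `N ≥ 1`; for `N = 0` the range `[1, 0]` is empty). -/
theorem modelDensity_zero_right (N u : ℕ) : modelDensity N u 0 = 0 := by
  unfold modelDensity
  rw [Finset.card_eq_zero.mpr ?_, Nat.cast_zero, zero_div]
  refine Finset.filter_eq_empty_iff.mpr ?_
  rintro n hn ⟨hlt, hΩ⟩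
  rw [Finset.mem_Icc] at hn
  rcases ArithmeticFunction.cardFactors_eq_zero_iff_eq_zero_or_one.mp hΩ with rfl | rfl
  · omega
  · have hN1 : (1 : ℝ) ≤ N := by exact_mod_cast hn.2
    have h1 : (1 : ℝ) ≤ (N : ℝ) ^ ((1 : ℝ) / u) := Real.one_le_rpow hN1 (by positivity)
    rw [Nat.minFac_one, Nat.cast_one] at hlt
    linarith

/-- **Schedule numerics for the density bounds.**  For `ε > 0` there is `N₀` such that for all `N ≥ N₀`:
`16 ≤ N`, and with `U = slowDegree N`, `4 (U^U)² ≤ (log N)^ε`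
(`2 U^U ≤ exp(2εU²)` for `U ≥ U₀(ε)` by `quantClip_powSelf_le_exp`, squared, and `exp(4εU²) ≤ (log N)^ε` from
`exp(4U²) ≤ log N`, `quantClip_schedule`). -/
theorem schedule_numerics {ε : ℝ} (hε : 0 < ε) :
    ∃ N₀ : ℕ, ∀ N : ℕ, N₀ ≤ N →
      16 ≤ N ∧ 4 * (((slowDegree N : ℕ) : ℝ) ^ slowDegree N) ^ 2 ≤ Real.log N ^ ε := by
  obtain ⟨U₁, hU₁⟩ := quantClip_powSelf_le_exp (by positivity : 0 < 2 * ε) 0 2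
  obtain ⟨N₀, hN₀⟩ := quantClip_schedule U₁
  refine ⟨N₀, fun N hN => ?_⟩
  obtain ⟨hU₁U, hN16, hexp, -⟩ := hN₀ N hN
  refine ⟨hN16, ?_⟩
  set U : ℕ := slowDegree N with hU
  have hpow : 2 * (U : ℝ) ^ U ≤ Real.exp (2 * ε * (U : ℝ) ^ 2) := by simpa using hU₁ U hU₁U
  have h1 : (2 * (U : ℝ) ^ U) ^ 2 ≤ Real.exp (2 * ε * (U : ℝ) ^ 2) ^ 2 :=
    pow_le_pow_left₀ (by positivity) hpow 2
  have h2 : Real.exp (2 * ε * (U : ℝ) ^ 2) ^ 2 = Real.exp (4 * (U : ℝ) ^ 2 * ε) := by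
    rw [sq, ← Real.exp_add]; congr 1; ring
  have h3 : Real.exp (4 * (U : ℝ) ^ 2 * ε) ≤ Real.log N ^ ε := by
    rw [Real.exp_mul]; exact Real.rpow_le_rpow (Real.exp_pos _).le hexp hε.le
  calc 4 * ((U : ℝ) ^ U) ^ 2 = (2 * (U : ℝ) ^ U) ^ 2 := by ring
    _ ≤ Real.exp (2 * ε * (U : ℝ) ^ 2) ^ 2 := h1
    _ = Real.exp (4 * (U : ℝ) ^ 2 * ε) := h2
    _ ≤ Real.log N ^ ε := h3

/-- **Two-sided anatomy in the form used here.**  If `AnatomyAlong`'s inequality holds at `(N, m)` then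
`(7/8) I_m(U) ≤ a_m log N ≤ (9/8) I_m(U)` (`e^{-U²} ≤ 1`). -/
theorem anatomy_two_sided {N m : ℕ}
    (h : |(cell (slowDegree N) N m : ℝ) * Real.log N / N - cellDensity (m - 1) (slowDegree N)| ≤
      Real.exp (-((slowDegree N : ℝ) ^ 2)) / 8 * cellDensity (m - 1) (slowDegree N)) :
    7 / 8 * cellDensity (m - 1) (slowDegree N) ≤ modelDensity N (slowDegree N) m * Real.log N ∧
      modelDensity N (slowDegree N) m * Real.log N ≤ 9 / 8 * cellDensity (m - 1) (slowDegree N) := by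
  set I : ℝ := cellDensity (m - 1) (slowDegree N) with hI
  have hI0 : 0 ≤ I := calc_nonneg _ _
  have he1 : Real.exp (-((slowDegree N : ℝ) ^ 2)) ≤ 1 :=
    Real.exp_le_one_iff.mpr (neg_nonpos.mpr (sq_nonneg _))
  have he : Real.exp (-((slowDegree N : ℝ) ^ 2)) / 8 * I ≤ 1 / 8 * I :=
    mul_le_mul_of_nonneg_right (by linarith) hI0
  have heq : modelDensity N (slowDegree N) m * Real.log N =
      (cell (slowDegree N) N m : ℝ) * Real.log N / N := by
    rw [modelDensity_eq_cell_div]; ring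
  obtain ⟨hlo, hhi⟩ := abs_le.mp h
  rw [heq]
  constructor <;> linarith

end DensityAlongAux

open DensityAlongAux in
/-- **Stub `stub_densityAlong` (registered): anatomy of the rough `Ω`-cells ALONG THE SCHEDULE in log-power
currency.**  For every `ε > 0` and all large `N`, with `U = slowDegree N`: `a_m ≤ (log N)^ε/log N` for all `m`,
`(log N)^{-ε}/log N ≤ a_m` for `1 ≤ m < U`, and `a_m = 0` for `m ≥ U` (from `stub_anatomyAlong`,
`1/(U^U)² ≤ I_m(U) ≤ U`, `4 (U^U)² ≤ (log N)^ε` along the schedule, and the emptiness of the top cells and of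
the cell `m = 0`).  The statement is written on one line, verbatim as registered. -/
theorem stub_densityAlong : ∀ ε : ℝ, 0 < ε → ∃ N₀ : ℕ, ∀ N : ℕ, N₀ ≤ N → (∀ m : ℕ, modelDensity N (slowDegree N) m ≤ Real.log N ^ ε / Real.log N) ∧ (∀ m : ℕ, 1 ≤ m → m < slowDegree N → Real.log N ^ (-ε) / Real.log N ≤ modelDensity N (slowDegree N) m) ∧ (∀ m : ℕ, slowDegree N ≤ m → modelDensity N (slowDegree N) m = 0) := by
  intro ε hε
  obtain ⟨N₁, hN₁⟩ := stub_anatomyAlong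
  obtain ⟨N₂, hN₂⟩ := schedule_numerics hε
  refine ⟨max N₁ N₂, fun N hN => ?_⟩
  have hA := hN₁ N (le_of_max_le_left hN)
  obtain ⟨hN16, hkey⟩ := hN₂ N (le_of_max_le_right hN)
  set U : ℕ := slowDegree N with hU
  have hU4 : 4 ≤ U := four_le_slowDegree N
  have hU1 : 1 ≤ U := le_trans (by norm_num) hU4
  have hU1' : (1 : ℝ) ≤ U := by exact_mod_cast hU1
  have hN16' : (16 : ℝ) ≤ N := by exact_mod_cast hN16
  have hLpos : 0 < Real.log N := Real.log_pos (by linarith)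
  have hLε0 : 0 ≤ Real.log N ^ ε := Real.rpow_nonneg hLpos.le ε
  -- `P = (U^U)²`: `1/P ≤ I_m(U)`, `U ≤ P`, `4P ≤ (log N)^ε`
  set P : ℝ := ((U : ℝ) ^ U) ^ 2 with hP
  have hP0 : 0 < P := by positivity
  have hUP : (U : ℝ) ≤ P := by
    have h1 : (U : ℝ) ^ 1 ≤ (U : ℝ) ^ (U * 2) := pow_le_pow_right₀ hU1' (by omega)
    rw [pow_one] at h1
    rw [hP, ← pow_mul]; exact h1
  have hLεP : 4 * P ≤ Real.log N ^ ε := hkey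
  -- the top cells
  have htop : ∀ m : ℕ, U ≤ m → modelDensity N U m = 0 := fun m hm => modelDensity_eq_zero hU1 hm
  refine ⟨fun m => ?_, fun m hm1 hmU => ?_, htop⟩
  · -- upper bound
    rcases Nat.eq_zero_or_pos m with rfl | hm1
    · rw [modelDensity_zero_right]; exact div_nonneg hLε0 hLpos.le
    rcases le_or_gt U m with hmU | hmU
    · rw [htop m hmU]; exact div_nonneg hLε0 hLpos.le
    have hm1' : 1 ≤ m := hm1
    obtain ⟨-, hhi⟩ := anatomy_two_sided (hA m hm1' hmU)
    have hIU : cellDensity (m - 1) (U : ℝ) ≤ U := cellDensity_le_self _ hU1'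
    rw [le_div_iff₀ hLpos]
    calc modelDensity N U m * Real.log N ≤ 9 / 8 * cellDensity (m - 1) (U : ℝ) := hhi
      _ ≤ 9 / 8 * U := by linarith
      _ ≤ 4 * P := by linarith
      _ ≤ Real.log N ^ ε := hLεP
  · -- lower bound on the bulk
    obtain ⟨hlo, -⟩ := anatomy_two_sided (hA m hm1 hmU)
    have hlow : 1 / P ≤ cellDensity (m - 1) (U : ℝ) :=
      anatomyAlong_densityLower_nat (by omega : (m - 1) + 2 ≤ U)
    rw [Real.rpow_neg hLpos.le, div_le_iff₀ hLpos]
    have h4P : 0 < 4 * P := by positivity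
    calc (Real.log N ^ ε)⁻¹ ≤ (4 * P)⁻¹ := inv_anti₀ h4P hLεP
      _ = 1 / 4 * (1 / P) := by field_simp
      _ ≤ 1 / 4 * cellDensity (m - 1) (U : ℝ) := by linarith
      _ ≤ 7 / 8 * cellDensity (m - 1) (U : ℝ) := by linarith [calc_nonneg (m - 1) (U : ℝ)]
      _ ≤ modelDensity N U m * Real.log N := hlo

end Summit.Parity.GeneralizedHardyLittlewood.Cruxes.CellParityLawSaving.SuperPolyBand

end
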